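import Mathlib
import Summits.Ventures.HodgeRepro.Tier4.Common.LocalCoordinatesConj
import Summits.Ventures.HodgeRepro.Tier4.Line1.FiniteLevelIsolation
import Summits.Ventures.HodgeRepro.Tier4.Line4.D3CoeffConj
import Summits.Ventures.HodgeRepro.Tier4.Line4.D3CoeffDelta

/-!
# Tier4/Line4/D3CoeffInfOnly — C-L4-INFONLY: the `infOnly` field of `IsArchCoeff` for the named witnesses `D3coeff'`,
`D3coeff''` — the `T′`-adapted coordinates, and with them the weight-3 coefficients, see only the archimedean part

Blind re-derivation cell `pub-hodge-repro`, Tier 4 «prove the step» (README §9–§10), seat t4-L4-p1 (prover, LINE L4,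
gen 4; L1-p5 g4's open item (1) S15105, owner named by the lead S15113).  Tree path
`lean/Summits/Ventures/HodgeRepro/Tier4/Line4/D3CoeffInfOnly.lean`.  Mathlib-level; no literature.

WHAT IS PROVED.  The complex coordinates at an infinite place `w` read an adelic matrix only through its archimedean
part: `adToC w (M i j) = φ_w ((infM M) i j)` (RowWeights' `adToC` = the extension embedding of the `w`-component, and the
`w`-component factors through `infPart`), so two adelic matrices with the same `infM` have the same `adToC`-entries
(`adToC_apply_eq_of_infM_eq`).  The archimedean part `GA.ofInfPart x` has `infM (mat (ofInfPart x)) = infM (mat x)`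
(`GA.mat_ofInfPart`, `infM_mixM`), and conjugation by the rational `g`, `g′` commutes with `infM` (`infM_mul`,
`mat_conjTo`); hence
* `locEntry'_ofInfPart` — `locEntry' … w (GA.ofInfPart _ x) I J = locEntry' … w x I J` (every `T′`-adapted coordinate);
* `D3coeff'_ofInfPart` / `D3coeff''_ofInfPart` — **the `infOnly` field** `finf x = finf (GA.ofInfPart W x)` of
  `L1Class.IsArchCoeff` (L1Class L285, Assembly-v33) for L1-p5's witnesses `D3coeff'` (D3CoeffConj p700675) and the `(0, 3)`
  twin `D3coeff''` (D3CoeffDelta p702993).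

Nothing here says anything about the status of the Hodge conjecture for CM abelian varieties, which is NOT proved
(HC_CM is NOT proved by anyone in this repository).
-/

set_option autoImplicit false

noncomputable section

namespace Summit.Ventures.HodgeRepro.Tier4.Line4

open Summit.Ventures.HodgeRepro.Tier4.Common Summit.Ventures.HodgeRepro.Tier4.Line1 NumberField Matrix
open scoped ComplexConjugate

section AdToC

variable {k : Type} [Field k] [NumberField k] (w : InfinitePlace k)

/-- **The complex entry at `w` depends on the archimedean part only**: two adelic matrices with the same `infM` have the
same `adToC w`-entries (`adToC w (M i j) = φ_w ((infM M i j) w)`). -/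
theorem adToC_apply_eq_of_infM_eq {M N : M4 k} (h : infM k M = infM k N) (i j : Fin 4) :
    adToC w (M i j) = adToC w (N i j) := by
  change InfinitePlace.Completion.extensionEmbedding w ((infM k M i j) w) =
    InfinitePlace.Completion.extensionEmbedding w ((infM k N i j) w)
  rw [h]

end AdToC

section InfOnly

variable {k : Type} [Field k] [NumberField k] (q : QuadData k) (a : Fin 4 → k)
  (g g' : Matrix (Fin 4) (Fin 4) k) (hgg' : g * g' = 1) (hg'g : g' * g = 1)
  (hgΩ : g * (PlaneData.mixedRow q (a 0) (a 2)).Ω = (PlaneData.mixedRow q (a 0) (a 2)).Ω * g)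
  (lam : k)
  (hiso : g * (PlaneData.mixedRow q (a 1) (a 3)).B * gᵀ = lam • (PlaneData.mixedRow q (a 0) (a 2)).B)
  (w : InfinitePlace k)

/-- The archimedean part of `g′ x g` is `g′ x_∞ g` (`infM` is multiplicative and forgets the finite part). -/
theorem infM_mat_conjTo_ofInfPart (x : GA ((PlaneData.mixedRow q (a 0) (a 2)).withTransportedTorus g g' hgg' hg'g hgΩ)) :
    infM k (GA.mat (PlaneData.ofLinesRow q (a 1) (a 3) (-1))
        (conjTo q a g g' hgg' hg'g hgΩ lam hiso (GA.ofInfPart _ x))) =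
      infM k (GA.mat (PlaneData.ofLinesRow q (a 1) (a 3) (-1)) (conjTo q a g g' hgg' hg'g hgΩ lam hiso x)) := by
  rw [mat_conjTo, mat_conjTo, infM_mul, infM_mul, infM_mul, infM_mul, GA.mat_ofInfPart, infM_mixM]

/-- **The `T′`-adapted coordinates see only the archimedean part.** -/
theorem locEntry'_ofInfPart (x : GA ((PlaneData.mixedRow q (a 0) (a 2)).withTransportedTorus g g' hgg' hg'g hgΩ))
    (I J : Fin 2) :
    locEntry' q a g g' hgg' hg'g hgΩ lam hiso w (GA.ofInfPart _ x) I J =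
      locEntry' q a g g' hgg' hg'g hgΩ lam hiso w x I J := by
  have h := infM_mat_conjTo_ofInfPart q a g g' hgg' hg'g hgΩ lam hiso x
  simp only [locEntry', locEntry, entryAt_eq_adToC]
  rw [adToC_apply_eq_of_infM_eq w h, adToC_apply_eq_of_infM_eq w h]

/-- **The `infOnly` field for `D3coeff'`**: `D3coeff' x = D3coeff' (GA.ofInfPart _ x)`. -/
theorem D3coeff'_ofInfPart (x : GA ((PlaneData.mixedRow q (a 0) (a 2)).withTransportedTorus g g' hgg' hg'g hgΩ)) :
    D3coeff' q a g g' hgg' hg'g hgΩ lam hiso w x =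
      D3coeff' q a g g' hgg' hg'g hgΩ lam hiso w (GA.ofInfPart _ x) := by
  rw [D3coeff'_eq, D3coeff'_eq, locEntry'_ofInfPart q a g g' hgg' hg'g hgΩ lam hiso w x]

/-- **The `infOnly` field for the `(0, 3)` twin `D3coeff''`**: `D3coeff'' x = D3coeff'' (GA.ofInfPart _ x)`. -/
theorem D3coeff''_ofInfPart (x : GA ((PlaneData.mixedRow q (a 0) (a 2)).withTransportedTorus g g' hgg' hg'g hgΩ)) :
    D3coeff'' q a g g' hgg' hg'g hgΩ lam hiso w x =
      D3coeff'' q a g g' hgg' hg'g hgΩ lam hiso w (GA.ofInfPart _ x) := by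
  rw [D3coeff''_eq, D3coeff''_eq, locEntry'_ofInfPart q a g g' hgg' hg'g hgΩ lam hiso w x]

end InfOnly

end Summit.Ventures.HodgeRepro.Tier4.Line4

end
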